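import Mathlib.LinearAlgebra.Matrix.Determinant.Basic
import Mathlib.Data.Matrix.Basic
import Mathlib.Logic.Equiv.Fintype
import HarnessLib

/-!
# The mixed discriminant (double alternating sum) of a family of square matrices

For a finite index type `ι` and a family `M : ι → Matrix ι ι R` of square matrices over a
commutative ring (one matrix per "slot" `s : ι`), the **mixed discriminant** is the double
alternating sum

  `mixedDisc M = ∑_{σ, τ ∈ S_ι} sgn σ sgn τ ∏_{s} M s (σ s) (τ s)`,

the full polarization of the determinant (`mixedDisc (fun _ ↦ A) = |ι|! · det A`; Aleksandrov
1938; Schneider, *Convex Bodies*, §5.5 for the mixed discriminant of quadratic forms; Bapat,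
*Mixed discriminants of positive semidefinite matrices*, Linear Algebra Appl. 126 (1989), (1)).
Such double `ε`-`ε` contractions are how fully covariant tensors of type `(0, 2|ι|)` are
integrated against the volume form twice: they appear in the coordinate Pfaffian (Euler density)
and in Chern's transgression form (`Literature/Geometry/Riemannian/ChernTransgression.lean`,
`eulerDensitySum`, `chernTransgressionSum`; Chern 1945, (9)–(10)).

This file proves the algebra that makes these contractions tensorial:

* `mixedDisc_update_eq`, `mixedDisc_update_add`, `mixedDisc_update_smul`,
  `mixedDisc_update_zero`, `mixedDisc_update_sum` — multilinearity in every slot;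
* `mixedDisc_transpose` — invariance under transposing every matrix (swap `σ ↔ τ`);
* `sum_sign_mul_prod_apply_eq_det_submatrix` — `∑_τ sgn τ ∏_s B (p s) (τ s) = det (B ∘ p)`
  for any map `p : ι → ι` (zero unless `p` is a bijection, by two equal rows);
* `mixedDisc_mul_right`, `mixedDisc_mul_left`, `mixedDisc_conj` — **covariance**:
  `mixedDisc (s ↦ M s * B) = det B · mixedDisc M`, `mixedDisc (s ↦ P * M s) = det P · mixedDisc M`,
  hence `mixedDisc (s ↦ Pᵀ * M s * P) = (det P)² · mixedDisc M` — the transformation law of a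
  double `ε`-`ε` contraction of bilinear forms under a change of basis `P` (the proof is that of
  `Matrix.det_mul`: expand the products of sums over maps `p : ι → ι`, the `τ`-sum is the
  determinant of `B` with rows selected by `p`, which vanishes unless `p` is a permutation).

Everything is proved; the one definition is the explicit finite sum `mixedDisc`.

## References

* R. B. Bapat, *Mixed discriminants of positive semidefinite matrices*, Linear Algebra Appl. 126
  (1989) 107–124, (1) (definition as the coefficient/polarization of `det`). [Bapat1989]
* S.-S. Chern, *On the curvatura integra in a Riemannian manifold*, Ann. of Math. 46 (1945)
  674–684, (9)–(10) (the double alternating sums of curvature and connection forms). [Chern1945]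
-/

noncomputable section

open Equiv Equiv.Perm Finset Matrix

namespace Literature.LinearAlgebra.Matrix

variable {ι : Type*} [Fintype ι] [DecidableEq ι] {R : Type*} [CommRing R]

/-- The **mixed discriminant** (double alternating sum) of a family of square matrices indexed
by the slots `s : ι`: `∑_{σ,τ} sgn σ sgn τ ∏ₛ M s (σ s) (τ s)`. For a constant family it is
`|ι|! det A`; in general it is the full polarization of `det`. [cite: Bapat1989, (1)] -/
def mixedDisc (M : ι → Matrix ι ι R) : R :=
  ∑ σ : Perm ι, ∑ τ : Perm ι,
    ((Equiv.Perm.sign σ : ℤ) : R) * ((Equiv.Perm.sign τ : ℤ) : R) * ∏ s, M s (σ s) (τ s)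

/-- Unfolding lemma for `mixedDisc`. [cite: Bapat1989, (1)] -/
theorem mixedDisc_def (M : ι → Matrix ι ι R) :
    mixedDisc M = ∑ σ : Perm ι, ∑ τ : Perm ι,
      ((Equiv.Perm.sign σ : ℤ) : R) * ((Equiv.Perm.sign τ : ℤ) : R) * ∏ s, M s (σ s) (τ s) :=
  rfl

/-! ### Multilinearity in each slot -/

/-- The product over the slots with one slot updated: the updated matrix factors out.
[folklore] -/
theorem prod_update_apply (M : ι → Matrix ι ι R) (s₀ : ι) (X : Matrix ι ι R) (σ τ : Perm ι) :
    ∏ s, Function.update M s₀ X s (σ s) (τ s) =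
      X (σ s₀) (τ s₀) * ∏ s ∈ univ.erase s₀, M s (σ s) (τ s) := by
  rw [← Finset.mul_prod_erase univ _ (mem_univ s₀)]
  congr 1
  · simp
  · refine Finset.prod_congr rfl fun s hs ↦ ?_
    rw [Function.update_of_ne (Finset.ne_of_mem_erase hs)]

/-- The mixed discriminant with one slot updated, as a sum in which the entries of the updated
matrix appear linearly. [folklore] -/
theorem mixedDisc_update_eq (M : ι → Matrix ι ι R) (s₀ : ι) (X : Matrix ι ι R) :
    mixedDisc (Function.update M s₀ X) = ∑ σ : Perm ι, ∑ τ : Perm ι,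
      ((Equiv.Perm.sign σ : ℤ) : R) * ((Equiv.Perm.sign τ : ℤ) : R) *
        (X (σ s₀) (τ s₀) * ∏ s ∈ univ.erase s₀, M s (σ s) (τ s)) := by
  simp only [mixedDisc, prod_update_apply]

/-- **Additivity in a slot.** [cite: Bapat1989, (1)] -/
theorem mixedDisc_update_add (M : ι → Matrix ι ι R) (s₀ : ι) (A B : Matrix ι ι R) :
    mixedDisc (Function.update M s₀ (A + B)) =
      mixedDisc (Function.update M s₀ A) + mixedDisc (Function.update M s₀ B) := by
  simp only [mixedDisc_update_eq, Matrix.add_apply, ← Finset.sum_add_distrib]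
  refine Finset.sum_congr rfl fun σ _ ↦ Finset.sum_congr rfl fun τ _ ↦ ?_
  ring

/-- **Homogeneity in a slot.** [cite: Bapat1989, (1)] -/
theorem mixedDisc_update_smul (M : ι → Matrix ι ι R) (s₀ : ι) (c : R) (A : Matrix ι ι R) :
    mixedDisc (Function.update M s₀ (c • A)) = c * mixedDisc (Function.update M s₀ A) := by
  simp only [mixedDisc_update_eq, Matrix.smul_apply, smul_eq_mul, Finset.mul_sum]
  refine Finset.sum_congr rfl fun σ _ ↦ Finset.sum_congr rfl fun τ _ ↦ ?_
  ring

/-- A zero slot kills the mixed discriminant. [cite: Bapat1989, (1)] -/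
theorem mixedDisc_update_zero (M : ι → Matrix ι ι R) (s₀ : ι) :
    mixedDisc (Function.update M s₀ 0) = 0 := by
  simp [mixedDisc_update_eq]

/-- **Finite additivity in a slot.** [cite: Bapat1989, (1)] -/
theorem mixedDisc_update_sum {κ : Type*} (t : Finset κ) (M : ι → Matrix ι ι R) (s₀ : ι)
    (A : κ → Matrix ι ι R) :
    mixedDisc (Function.update M s₀ (∑ k ∈ t, A k)) =
      ∑ k ∈ t, mixedDisc (Function.update M s₀ (A k)) := by
  classical
  induction t using Finset.induction_on with
  | empty => simp [mixedDisc_update_zero]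
  | insert k t hk ih => rw [Finset.sum_insert hk, mixedDisc_update_add, ih, Finset.sum_insert hk]

/-- If two families agree slotwise, their mixed discriminants agree (congruence helper).
[folklore] -/
theorem mixedDisc_congr {M M' : ι → Matrix ι ι R} (h : ∀ s, M s = M' s) :
    mixedDisc M = mixedDisc M' := by
  rw [show M = M' from funext h]

/-! ### Transposition -/

/-- **Transposing every matrix does not change the mixed discriminant** (swap the two
permutations). [cite: Bapat1989, (1)] -/
theorem mixedDisc_transpose (M : ι → Matrix ι ι R) :
    mixedDisc (fun s ↦ (M s)ᵀ) = mixedDisc M := by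
  unfold mixedDisc
  rw [Finset.sum_comm]
  refine Finset.sum_congr rfl fun σ _ ↦ Finset.sum_congr rfl fun τ _ ↦ ?_
  simp only [Matrix.transpose_apply]
  ring

/-! ### The `τ`-sum against a matrix with selected rows is a determinant -/

/-- For any map `p : ι → ι`, `∑_τ sgn τ ∏ₛ B (p s) (τ s) = det (B.submatrix p id)` (the
determinant of the matrix whose `s`-th row is the `p s`-th row of `B`). [folklore] -/
theorem sum_sign_mul_prod_apply_eq_det_submatrix (B : Matrix ι ι R) (p : ι → ι) :
    ∑ τ : Perm ι, ((Equiv.Perm.sign τ : ℤ) : R) * ∏ s, B (p s) (τ s) =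
      (B.submatrix p id).det := by
  rw [Matrix.det_apply']
  -- reindex `τ ↦ τ⁻¹`
  rw [← Equiv.sum_comp (Equiv.inv (Perm ι))]
  refine Finset.sum_congr rfl fun τ _ ↦ ?_
  simp only [Equiv.inv_apply, Equiv.Perm.sign_inv, Matrix.submatrix_apply, id_eq]
  congr 1
  -- `∏ s, B (p s) (τ⁻¹ s) = ∏ i, B (p (τ i)) i`, substituting `s = τ i`
  rw [← Equiv.prod_comp τ]
  simp

/-- If `p` is not a bijection, the selected-rows determinant vanishes (two equal rows).
[folklore] -/
theorem det_submatrix_eq_zero_of_not_bijective (B : Matrix ι ι R) {p : ι → ι}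
    (hp : ¬ Function.Bijective p) : (B.submatrix p id).det = 0 := by
  have hinj : ¬ Function.Injective p := fun hi ↦ hp (Finite.injective_iff_bijective.1 hi)
  obtain ⟨i, j, hij, hne⟩ := Function.not_injective_iff.1 hinj
  exact Matrix.det_zero_of_row_eq hne (by ext k; simp [hij])

/-- For a permutation `ρ`, the selected-rows determinant is `sgn ρ · det B`. [folklore] -/
theorem det_submatrix_perm (B : Matrix ι ι R) (ρ : Perm ι) :
    (B.submatrix ρ id).det = ((Equiv.Perm.sign ρ : ℤ) : R) * B.det := by
  rw [Matrix.det_permute]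

/-! ### Covariance under right and left multiplication -/

/-- A sum over all maps `ι → ι` of a function vanishing off the bijections is the sum over the
permutations. [folklore] -/
theorem sum_univ_fun_eq_sum_perm {β : Type*} [AddCommMonoid β] (F : (ι → ι) → β)
    (hF : ∀ p : ι → ι, ¬ Function.Bijective p → F p = 0) :
    ∑ p : ι → ι, F p = ∑ ρ : Perm ι, F ρ := by
  classical
  have himage : (univ : Finset (Perm ι)).map ⟨fun ρ : Perm ι ↦ (ρ : ι → ι),
      fun ρ ρ' h ↦ Equiv.ext (congrFun h)⟩ ⊆ (univ : Finset (ι → ι)) := subset_univ _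
  rw [← Finset.sum_subset himage]
  · rw [Finset.sum_map]
    rfl
  · intro p _ hp
    apply hF
    intro hbij
    apply hp
    rw [Finset.mem_map]
    exact ⟨Equiv.ofBijective p hbij, mem_univ _, rfl⟩

/-- **Covariance under right multiplication**: `mixedDisc (s ↦ M s * B) = det B · mixedDisc M`
(the proof of `det (M * B) = det M det B` slot by slot: expand the products of sums over maps
`p : ι → ι`; for fixed `p` the `τ`-sum is `det (B ∘ p)`, which is `sgn p · det B` on
permutations and `0` otherwise). [cite: Bapat1989, (1)] -/
theorem mixedDisc_mul_right (M : ι → Matrix ι ι R) (B : Matrix ι ι R) :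
    mixedDisc (fun s ↦ M s * B) = B.det * mixedDisc M := by
  classical
  -- expand the product of sums
  have h1 : ∀ σ τ : Perm ι, (∏ s, (M s * B) (σ s) (τ s)) =
      ∑ p : ι → ι, (∏ s, M s (σ s) (p s)) * ∏ s, B (p s) (τ s) := by
    intro σ τ
    have h : ∀ s, (M s * B) (σ s) (τ s) = ∑ j, M s (σ s) j * B j (τ s) := fun s ↦ Matrix.mul_apply
    simp_rw [h]
    rw [Finset.prod_univ_sum]
    simp only [Fintype.piFinset_univ, Finset.prod_mul_distrib]
  -- the identity for each fixed `σ`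
  have key : ∀ σ : Perm ι,
      (∑ τ : Perm ι, ((sign σ : ℤ) : R) * ((sign τ : ℤ) : R) * ∏ s, (M s * B) (σ s) (τ s)) =
        B.det * ∑ τ : Perm ι, ((sign σ : ℤ) : R) * ((sign τ : ℤ) : R) * ∏ s, M s (σ s) (τ s) := by
    intro σ
    calc (∑ τ : Perm ι, ((sign σ : ℤ) : R) * ((sign τ : ℤ) : R) * ∏ s, (M s * B) (σ s) (τ s))
        = ∑ τ : Perm ι, ∑ p : ι → ι, ((sign σ : ℤ) : R) * ((sign τ : ℤ) : R) *
            ((∏ s, M s (σ s) (p s)) * ∏ s, B (p s) (τ s)) := by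
          refine Finset.sum_congr rfl fun τ _ ↦ ?_
          rw [h1 σ τ, Finset.mul_sum]
      _ = ∑ p : ι → ι, ((sign σ : ℤ) : R) * (∏ s, M s (σ s) (p s)) * (B.submatrix p id).det := by
          rw [Finset.sum_comm]
          refine Finset.sum_congr rfl fun p _ ↦ ?_
          rw [← sum_sign_mul_prod_apply_eq_det_submatrix, Finset.mul_sum]
          refine Finset.sum_congr rfl fun τ _ ↦ ?_
          ring
      _ = ∑ ρ : Perm ι, ((sign σ : ℤ) : R) * (∏ s, M s (σ s) (ρ s)) * (B.submatrix ρ id).det := by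
          refine sum_univ_fun_eq_sum_perm _ fun p hp ↦ ?_
          rw [det_submatrix_eq_zero_of_not_bijective B hp, mul_zero]
      _ = B.det * ∑ τ : Perm ι, ((sign σ : ℤ) : R) * ((sign τ : ℤ) : R) * ∏ s, M s (σ s) (τ s) := by
          rw [Finset.mul_sum]
          refine Finset.sum_congr rfl fun ρ _ ↦ ?_
          rw [det_submatrix_perm]
          ring
  unfold mixedDisc
  rw [Finset.mul_sum]
  exact Finset.sum_congr rfl fun σ _ ↦ key σ

/-- **Covariance under left multiplication**: `mixedDisc (s ↦ P * M s) = det P · mixedDisc M`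
(transpose and use `mixedDisc_mul_right`). [cite: Bapat1989, (1)] -/
theorem mixedDisc_mul_left (P : Matrix ι ι R) (M : ι → Matrix ι ι R) :
    mixedDisc (fun s ↦ P * M s) = P.det * mixedDisc M := by
  rw [← mixedDisc_transpose]
  have h : (fun s ↦ (P * M s)ᵀ) = fun s ↦ (M s)ᵀ * Pᵀ := by
    funext s
    rw [Matrix.transpose_mul]
  rw [h, mixedDisc_mul_right, Matrix.det_transpose, mixedDisc_transpose]

/-- **The transformation law under a change of basis**: for bilinear forms with matrices `M s`,
whose matrices in a new basis with transition matrix `P` are `Pᵀ (M s) P`,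
`mixedDisc (s ↦ Pᵀ * M s * P) = (det P)² · mixedDisc M` — a double `ε`-`ε` contraction of
bilinear forms is a density of weight two. [cite: Bapat1989, (1)] -/
theorem mixedDisc_conj (P : Matrix ι ι R) (M : ι → Matrix ι ι R) :
    mixedDisc (fun s ↦ Pᵀ * M s * P) = P.det ^ 2 * mixedDisc M := by
  rw [mixedDisc_mul_right (fun s ↦ Pᵀ * M s) P, mixedDisc_mul_left, Matrix.det_transpose]
  ring

/-- Slotwise version of the transformation law: different left and right factors,
`mixedDisc (s ↦ P * M s * Q) = det P · det Q · mixedDisc M`. [cite: Bapat1989, (1)] -/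
theorem mixedDisc_mul_mul (P Q : Matrix ι ι R) (M : ι → Matrix ι ι R) :
    mixedDisc (fun s ↦ P * M s * Q) = P.det * Q.det * mixedDisc M := by
  rw [mixedDisc_mul_right (fun s ↦ P * M s) Q, mixedDisc_mul_left]
  ring

/-! ## Vanishing on two parallel rank-one slots -/

/-- **Two rank-one slots with the same vector kill the mixed discriminant**: if
`M s₀ = v ⊗ a` and `M s₁ = v ⊗ θ` for `s₀ ≠ s₁` then `mixedDisc M = 0` (the involution
`σ ↦ σ ∘ (s₀ s₁)` reverses the sign of each term of the `σ`-sum; equivalently, two proportional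
columns in every `τ`-slice). [cite: Bapat1989, (1)] -/
theorem mixedDisc_eq_zero_of_vecMulVec (M : ι → Matrix ι ι R) {s₀ s₁ : ι} (hs : s₀ ≠ s₁)
    (v a θ : ι → R) (h0 : M s₀ = vecMulVec v a) (h1 : M s₁ = vecMulVec v θ) :
    mixedDisc M = 0 := by
  unfold mixedDisc
  rw [Finset.sum_comm]
  refine Finset.sum_eq_zero fun τ _ ↦ ?_
  refine Finset.sum_involution (fun σ _ ↦ σ * Equiv.swap s₀ s₁) ?_ ?_ ?_ ?_
  · intro σ _
    have hprod : (∏ s, M s ((σ * Equiv.swap s₀ s₁) s) (τ s)) = ∏ s, M s (σ s) (τ s) := by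
      rw [← Finset.mul_prod_erase _ _ (Finset.mem_univ s₀),
        ← Finset.mul_prod_erase _ _ (Finset.mem_univ s₀)]
      have hs₁ : s₁ ∈ Finset.univ.erase s₀ := Finset.mem_erase.2 ⟨hs.symm, Finset.mem_univ _⟩
      rw [← Finset.mul_prod_erase _ _ hs₁, ← Finset.mul_prod_erase _ _ hs₁]
      have hrest : ∀ s ∈ (Finset.univ.erase s₀).erase s₁,
          M s ((σ * Equiv.swap s₀ s₁) s) (τ s) = M s (σ s) (τ s) := by
        intro s hs'
        have hs0 : s ≠ s₀ := Finset.ne_of_mem_erase (Finset.mem_of_mem_erase hs')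
        have hs1 : s ≠ s₁ := Finset.ne_of_mem_erase hs'
        rw [Equiv.Perm.coe_mul, Function.comp_apply, Equiv.swap_apply_of_ne_of_ne hs0 hs1]
      rw [Finset.prod_congr rfl hrest, Equiv.Perm.coe_mul, Function.comp_apply,
        Function.comp_apply, Equiv.swap_apply_left, Equiv.swap_apply_right, h0, h1]
      simp only [vecMulVec_apply]
      ring
    rw [hprod, Equiv.Perm.sign_mul, Equiv.Perm.sign_swap hs]
    push_cast
    ring
  · intro σ _ _ heq
    exfalso
    have := congrArg (fun π : Equiv.Perm ι ↦ π s₀) heq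
    simp only [Equiv.Perm.coe_mul, Function.comp_apply, Equiv.swap_apply_left] at this
    exact hs (σ.injective this.symm)
  · intro σ _
    exact Finset.mem_univ _
  · intro σ _
    rw [mul_assoc, Equiv.swap_mul_self, mul_one]

end Literature.LinearAlgebra.Matrix

end
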